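import Literature.NumberTheory.Automorphic.CarayolCompatibilityOfLocalGlobalProofs
import Literature.NumberTheory.GaloisRepresentations.WeilDeligneRepProofs
import HarnessLib

/-!
# The Euler factor of a Weil–Deligne representation: isomorphism invariance, Frobenius
# semisimplification, transport along `ι`, and the eigenline when `(1 - αT) ∣ det(1 - TΦ | (ker N)^I)`

Topic `Literature/NumberTheory/Automorphic`; proof file (THEOREMS ONLY: no definition, no named
fact, no instance; D-0026).  Linear algebra around Tate's Euler factor
`det(1 - T·ρ(Φ) | (ker N)^{I_F})` (`WeilDeligneRep.eulerFactor`, Corvallis 1979, (4.1.6)) needed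
to read a Frobenius EIGENVALUE off the local Langlands correspondence (clause (iii-L)
`lFactor_pairs` of `IsLocalLanglandsGL`) and to move it to the `ℓ`-adic side of the
Grothendieck–Deligne dictionary (`IsWeilDeligneOfLadic`):

* `eulerFactor_eq_of_equiv` — isomorphic Weil–Deligne representations have the same Euler factor;
  `eulerFactor_tprod_eq_of_trivial` — `A ⊗ 𝟙` and `A` (`𝟙` one-dimensional, trivial, `N = 0`);
  `eulerFactor_eq_of_isFrobSemisimplificationOf` — `r^{F-ss}` and `r` (a commuting nilpotent
  perturbation of `ρ(Φ)|` does not change the characteristic polynomial);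
  `eulerFactor_tprod_out_eq_of_hasClass` — for a local Langlands datum `d`, the polynomial
  `det(1 - TΦ | (ker N)^I)` of `(d.recGL n ⟦π⟧).out ⊗ (d.recGL 1 ⟦𝟙⟧).out` (the right-hand side of
  `lFactor_pairs` for the pair `(π, 𝟙)`) is the Euler factor of EVERY Frobenius-semisimple `W` of
  class `d.recGL n ⟦π⟧` (clause (ii) `gl_one`).
* `exists_mem_inertiaInvariantsKerN_apply_eq_smul` — if `(1 - αX)` divides the Euler factor,
  `α ≠ 0`, and `dim (ker N)^I ≤ 1`, then `(ker N)^I` is a line on which every geometric Frobenius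
  acts by `α` (Cayley–Hamilton on the line).
* `IsTransportAlong.apply_comp_eq`, `….N_comp_eq`, `….exists_of_eigenvector`,
  `….N_eq_zero_and_ρ_eq_one_of_eq_top` — moving vectors and the unramified case back along
  `ι : E ≃ ℂ`.
* `IsWeilDeligneOfLadic.mulVec_eq_self_of_mem_inertia`, `….exists_deg_eq_neg_one_mulVec_eq`,
  `….eq_one_of_mem_inertia_of_N_eq_zero` — on a vector killed by `N` and fixed by `ρ_WD(I_F)` the
  `ℓ`-adic `ρ(u) = ρ_WD(u) exp(t(u)N)` acts trivially, `ρ(Φ) = ρ_WD(Φ)` for the Frobenius of the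
  recipe, and `ρ` is unramified when `(ρ_WD, N)` is.

## References

* J. Tate, *Number theoretic background*, Corvallis 1979, (4.1.2)–(4.1.6), (4.2.1). [TateCorvallis1979]
* P. Deligne, *Les constantes des équations fonctionnelles des fonctions `L`*, Antwerp II (1973),
  §8.4–8.6, §8.12. [DeligneAntwerpII1973]
* M. Harris, R. Taylor, Ann. of Math. Stud. 151 (2001), Thm. A (ii), (v). [HarrisTaylorAMS2001]
-/

noncomputable section

open scoped MatrixGroups Matrix TensorProduct
open Polynomial MeasureTheory ValuativeRel

namespace Literature.NumberTheory.Automorphic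

open Literature.NumberTheory.GaloisRepresentations
open Literature.NumberTheory.GaloisRepresentations.IsNonarchimedeanLocalField

/-! ### Part 1: isomorphism invariance of the Euler factor -/

section Invariance

variable {F : Type*} [Field F] [ValuativeRel F] [TopologicalSpace F] [IsNonarchimedeanLocalField F]
variable {C : Type*} [Field C] [CharZero C] {V : Type*} [AddCommGroup V] [Module C V]
  {V' : Type*} [AddCommGroup V'] [Module C V']

/-- A linear isomorphism intertwining the Weil-group actions and the monodromy operators maps
`(ker N)^{I_F}` onto `(ker N')^{I_F}`.  Deligne, Antwerp II (1973), §8.4.1. [folklore] -/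
theorem map_inertiaInvariantsKerN_eq_of_linearEquiv {r : WeilDeligneRep F C V} {r' : WeilDeligneRep F C V'}
    (φ : V ≃ₗ[C] V') (hφρ : ∀ (w : WeilGroup F) (x : V), φ (r.ρ w x) = r'.ρ w (φ x))
    (hφN : ∀ x : V, φ (r.N x) = r'.N (φ x)) :
    r.inertiaInvariantsKerN.map (φ : V →ₗ[C] V') = r'.inertiaInvariantsKerN := by
  apply le_antisymm
  · rintro _ ⟨x, hx, rfl⟩
    rw [SetLike.mem_coe, r.mem_inertiaInvariantsKerN_iff] at hx
    rw [r'.mem_inertiaInvariantsKerN_iff]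
    refine ⟨?_, fun u hu => ?_⟩
    · rw [LinearEquiv.coe_coe, ← hφN, hx.1, map_zero]
    · rw [LinearEquiv.coe_coe, ← hφρ, hx.2 u hu]
  · intro y hy
    rw [r'.mem_inertiaInvariantsKerN_iff] at hy
    refine ⟨φ.symm y, ?_, by simp⟩
    rw [SetLike.mem_coe, r.mem_inertiaInvariantsKerN_iff]
    refine ⟨?_, fun u hu => ?_⟩
    · apply φ.injective
      rw [hφN, φ.apply_symm_apply, hy.1, map_zero]
    · apply φ.injective
      rw [hφρ, φ.apply_symm_apply, hy.2 u hu]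

variable [FiniteDimensional C V] [FiniteDimensional C V']

/-- **The Euler factor is invariant under intertwining linear isomorphisms**: if `φ : V ≃ V'`
intertwines the Weil-group actions and the monodromy operators of `r`, `r'`, then
`det(1 - TΦ | (ker N)^I)` agrees (`φ` restricts to `(ker N)^I ≅ (ker N')^I` conjugating the two
actions of `Φ`; `charpoly` is conjugation invariant).  Tate, Corvallis 1979, (4.1.6).
[cite: TateCorvallis1979, (4.1.6)] -/
theorem eulerFactor_eq_of_linearEquiv {r : WeilDeligneRep F C V} {r' : WeilDeligneRep F C V'}
    (φ : V ≃ₗ[C] V') (hφρ : ∀ (w : WeilGroup F) (x : V), φ (r.ρ w x) = r'.ρ w (φ x))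
    (hφN : ∀ x : V, φ (r.N x) = r'.N (φ x)) (hn : absInertia_normal F) (hex : exists_isFrobPow (F := F)) :
    r.eulerFactor hn hex = r'.eulerFactor hn hex := by
  have hmap := map_inertiaInvariantsKerN_eq_of_linearEquiv φ hφρ hφN
  set ψ : r.inertiaInvariantsKerN ≃ₗ[C] r'.inertiaInvariantsKerN :=
    LinearEquiv.ofSubmodules φ _ _ hmap with hψ
  have hΦ : WeilGroup.deg (WeilDeligneRep.geomFrob F hex) = -1 := WeilDeligneRep.deg_geomFrob' hex
  rw [r.eulerFactor_eq_reverse_charpoly hn hex hΦ, r'.eulerFactor_eq_reverse_charpoly hn hex hΦ]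
  congr 1
  have hconj : ψ.conj (r.restrictInertiaInvariantsKerN hn (WeilDeligneRep.geomFrob F hex)) =
      r'.restrictInertiaInvariantsKerN hn (WeilDeligneRep.geomFrob F hex) := by
    refine LinearMap.ext fun y => Subtype.ext ?_
    rw [LinearEquiv.conj_apply_apply, WeilDeligneRep.coe_restrictInertiaInvariantsKerN_apply, hψ,
      LinearEquiv.ofSubmodules_apply, WeilDeligneRep.coe_restrictInertiaInvariantsKerN_apply,
      LinearEquiv.ofSubmodules_symm_apply, hφρ, φ.apply_symm_apply]
  rw [← hconj, LinearEquiv.charpoly_conj]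

/-- **The Euler factor is an isomorphism invariant** of Weil–Deligne representations
(`WeilDeligneRep.Equiv`).  Tate, Corvallis 1979, (4.1.6). [cite: TateCorvallis1979, (4.1.6)] -/
theorem eulerFactor_eq_of_equiv {r : WeilDeligneRep F C V} {r' : WeilDeligneRep F C V'}
    (e : WeilDeligneRep.Equiv r r') (hn : absInertia_normal F) (hex : exists_isFrobPow (F := F)) :
    r.eulerFactor hn hex = r'.eulerFactor hn hex := by
  refine eulerFactor_eq_of_linearEquiv e.toRepEquiv.toLinearEquiv (fun w x => ?_)
    (fun x => LinearMap.congr_fun e.comm_N x) hn hex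
  rw [Representation.Equiv.toLinearEquiv_apply, Representation.Equiv.toLinearEquiv_apply]
  exact Representation.IntertwiningMap.isIntertwining _ _ e.toRepEquiv.toIntertwiningMap w x

omit [FiniteDimensional C V'] in
/-- **`det(1 - TΦ | (ker N)^I)` of `A ⊗ 𝟙` is that of `A`** for a one-dimensional partner `𝟙` on
`Fin 1 → C` with trivial Weil-group action and `N = 0`: `a ⊗ b ↦ a` is an isomorphism
`A ⊗ 𝟙 ≅ A`.  Deligne, Antwerp II (1973), (8.1.2), §8.12. [folklore] -/
theorem eulerFactor_tprod_eq_of_trivial (A : WeilDeligneRep F C V) (B : WeilDeligneRep F C (Fin 1 → C))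
    (hBρ : ∀ (w : WeilGroup F) (x : Fin 1 → C), B.ρ w x = x) (hBN : B.N = 0)
    (hn : absInertia_normal F) (hex : exists_isFrobPow (F := F)) :
    (A.tprod B).eulerFactor hn hex = A.eulerFactor hn hex := by
  classical
  -- the linear isomorphism `V ⊗ C¹ ≃ V`, `y ⊗ c ↦ c 0 • y`
  obtain ⟨Φ, hΦ_tmul⟩ : ∃ Φ : V ⊗[C] (Fin 1 → C) ≃ₗ[C] V, ∀ (y : V) (c : Fin 1 → C), Φ (y ⊗ₜ c) = c 0 • y :=
    ⟨(TensorProduct.congr (LinearEquiv.refl C V) (LinearEquiv.funUnique (Fin 1) C C)).trans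
      (TensorProduct.rid C V), fun y c => by
        simp [TensorProduct.congr_tmul, TensorProduct.rid_tmul, LinearEquiv.funUnique_apply]⟩
  -- it intertwines the actions and the monodromy operators
  have hρ : ∀ (w : WeilGroup F) (z : V ⊗[C] (Fin 1 → C)), Φ ((A.tprod B).ρ w z) = A.ρ w (Φ z) := by
    intro w z
    induction z using TensorProduct.induction_on with
    | zero => rw [map_zero, map_zero, map_zero]
    | tmul y c =>
        rw [WeilDeligneRep.tprod_ρ_apply, TensorProduct.map_tmul, hBρ w, hΦ_tmul, hΦ_tmul, map_smul]
    | add x y hx hy => rw [map_add, map_add, hx, hy, map_add, map_add]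
  have hN : ∀ z : V ⊗[C] (Fin 1 → C), Φ ((A.tprod B).N z) = A.N (Φ z) := by
    intro z
    induction z using TensorProduct.induction_on with
    | zero => rw [map_zero, map_zero, map_zero]
    | tmul y c =>
        rw [WeilDeligneRep.tprod_N, LinearMap.add_apply, TensorProduct.map_tmul, TensorProduct.map_tmul, hBN,
          LinearMap.zero_apply, TensorProduct.tmul_zero, add_zero, Module.End.one_apply, hΦ_tmul, hΦ_tmul,
          map_smul]
    | add x y hx hy => rw [map_add, map_add, hx, hy, map_add, map_add]
  exact eulerFactor_eq_of_linearEquiv Φ hρ hN hn hex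

omit [FiniteDimensional C V'] in
/-- **Frobenius semisimplification does not change the Euler factor.**  If `r'` is a
Frobenius-semisimplification of `r` (same `N`, same inertia action, `r.ρ w = r'.ρ w + n_w` with
`n_w` nilpotent commuting with `r'.ρ w`), then `(ker N)^I` is the same subspace for both and on it
`ρ(Φ)|` and `ρ'(Φ)|` differ by a commuting nilpotent, so `det(1 - TΦ | (ker N)^I)` agrees.
Deligne, Antwerp II (1973), §8.6; Tate, Corvallis 1979, (4.1.3), (4.1.6).
[cite: DeligneAntwerpII1973, §8.6] [cite: TateCorvallis1979, (4.1.6)] -/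
theorem eulerFactor_eq_of_isFrobSemisimplificationOf {r' r : WeilDeligneRep F C V}
    (h : r'.IsFrobSemisimplificationOf r) (hn : absInertia_normal F) (hex : exists_isFrobPow (F := F)) :
    r'.eulerFactor hn hex = r.eulerFactor hn hex := by
  obtain ⟨hN, hI, hss⟩ := h
  have hS : r'.inertiaInvariantsKerN = r.inertiaInvariantsKerN := by
    ext v
    rw [r'.mem_inertiaInvariantsKerN_iff, r.mem_inertiaInvariantsKerN_iff, hN]
    refine ⟨fun hv => ⟨hv.1, fun u hu => ?_⟩, fun hv => ⟨hv.1, fun u hu => ?_⟩⟩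
    · rw [← hI u hu]; exact hv.2 u hu
    · rw [hI u hu]; exact hv.2 u hu
  set Φ := WeilDeligneRep.geomFrob F hex with hΦdef
  have hΦ : WeilGroup.deg Φ = -1 := WeilDeligneRep.deg_geomFrob' hex
  obtain ⟨-, n, hn_nil, hcomm, hsum⟩ := hss Φ
  -- `n` preserves `S = (ker N)^I` (as `r.ρ Φ` and `r'.ρ Φ` do)
  have hnS : ∀ v ∈ r'.inertiaInvariantsKerN, n v ∈ r'.inertiaInvariantsKerN := by
    intro v hv
    have h1 : r'.ρ Φ v ∈ r'.inertiaInvariantsKerN := r'.ρ_apply_mem_inertiaInvariantsKerN hn Φ hv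
    have h2 : r.ρ Φ v ∈ r'.inertiaInvariantsKerN := by
      rw [hS] at hv ⊢
      exact r.ρ_apply_mem_inertiaInvariantsKerN hn Φ hv
    have h3 : n v = r.ρ Φ v - r'.ρ Φ v := by
      rw [hsum, LinearMap.add_apply]; abel
    rw [h3]
    exact Submodule.sub_mem _ h2 h1
  set nS : Module.End C r'.inertiaInvariantsKerN := n.restrict hnS with hnS_def
  have hnS_nil : IsNilpotent nS := by
    obtain ⟨k, hk⟩ := hn_nil
    refine ⟨k, LinearMap.ext fun v => Subtype.ext ?_⟩
    rw [hnS_def, Module.End.pow_restrict, LinearMap.coe_restrict_apply, hk, LinearMap.zero_apply,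
      LinearMap.zero_apply, ZeroMemClass.coe_zero]
  have hcommS : Commute nS (r'.restrictInertiaInvariantsKerN hn Φ) := by
    refine LinearMap.ext fun v => Subtype.ext ?_
    change (n (r'.ρ Φ v) : V) = r'.ρ Φ (n v)
    exact LinearMap.congr_fun hcomm.eq v
  -- `r.ρ Φ| = r'.ρ Φ| + n|` on the common subspace
  have hrestr : ∀ v : r.inertiaInvariantsKerN,
      (r.restrictInertiaInvariantsKerN hn Φ v : V) = r'.ρ Φ v + n v := fun v => by
    rw [WeilDeligneRep.coe_restrictInertiaInvariantsKerN_apply, hsum, LinearMap.add_apply]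
  rw [r'.eulerFactor_eq_reverse_charpoly hn hex hΦ, r.eulerFactor_eq_reverse_charpoly hn hex hΦ]
  congr 1
  -- transport `r.ρ Φ|` to an endomorphism of `r'.inertiaInvariantsKerN` along `hS`
  set e : r.inertiaInvariantsKerN ≃ₗ[C] r'.inertiaInvariantsKerN := LinearEquiv.ofEq _ _ hS.symm with he
  have hconj : e.conj (r.restrictInertiaInvariantsKerN hn Φ) =
      r'.restrictInertiaInvariantsKerN hn Φ + nS := by
    refine LinearMap.ext fun v => Subtype.ext ?_
    rw [LinearEquiv.conj_apply_apply, LinearMap.add_apply, Submodule.coe_add,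
      WeilDeligneRep.coe_restrictInertiaInvariantsKerN_apply, hnS_def, LinearMap.coe_restrict_apply, he,
      LinearEquiv.coe_ofEq_apply, hrestr, LinearEquiv.ofEq_symm, LinearEquiv.coe_ofEq_apply]
  rw [← LinearEquiv.charpoly_conj e, hconj]
  -- a commuting nilpotent perturbation does not change the characteristic polynomial
  set b := Module.finBasis C r'.inertiaInvariantsKerN
  rw [← LinearMap.charpoly_toMatrix (r'.restrictInertiaInvariantsKerN hn Φ + nS) b,
    ← LinearMap.charpoly_toMatrix (r'.restrictInertiaInvariantsKerN hn Φ) b, map_add]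
  have h1 : IsNilpotent (LinearMap.toMatrix b b nS) := hnS_nil.map (LinearMap.toMatrixAlgEquiv b)
  have h2 : Commute (LinearMap.toMatrix b b (r'.restrictInertiaInvariantsKerN hn Φ)) (LinearMap.toMatrix b b nS) :=
    hcommS.symm.map (LinearMap.toMatrixAlgEquiv b)
  rw [Matrix.charpoly_add_eq_of_isNilpotent_of_commute h1 h2]

end Invariance

/-! ### Part 2: the right-hand side of `lFactor_pairs` for the pair `(π, 𝟙)` -/

section LLC

variable {F : Type} [Field F] [ValuativeRel F] [TopologicalSpace F] [IsNonarchimedeanLocalField F]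

/-- **`det(1 - TΦ | (ker N)^I)` of `(d.recGL n ⟦π⟧).out ⊗ (d.recGL 1 ⟦𝟙⟧).out` is the Euler factor of
every Frobenius-semisimple `W` of class `d.recGL n ⟦π⟧`** (`d` a local Langlands datum, `𝟙` the
trivial representation of `GL₁(F)`): by clause (ii) `gl_one` the second factor is isomorphic to
`(1 ∘ artin, N = 0)`, hence has trivial action and `N = 0` (`eulerFactor_tprod_eq_of_trivial`),
and `W ≅ (d.recGL n ⟦π⟧).out` (`Quotient.exact`, `eulerFactor_eq_of_equiv`).  This is the
polynomial of the right-hand side of clause (iii-L) `lFactor_pairs` for the pair `(π, 𝟙)`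
(Harris–Taylor 2001, Thm. A (ii), (v); Tate, Corvallis 1979, (4.1.6)).
[cite: HarrisTaylorAMS2001, Thm. A (ii), (v)] [cite: TateCorvallis1979, (4.1.6)] -/
theorem eulerFactor_tprod_out_eq_of_hasClass (d : LocalLanglandsDatum F) {n : ℕ}
    (πv : SmoothIrrep (GL (Fin n) F)) (π' : SmoothIrrep (GL (Fin 1) F))
    (hπ' : ∀ (x : GL (Fin 1) F) (v : π'.V), π'.ρ x v = v)
    (W : WeilDeligneRep F ℂ (Fin n → ℂ)) (hW : W.IsFrobSemisimple)
    (hq : Quotient.mk (frobSemisimpleWDSetoid F n) ⟨W, hW⟩ = d.recGL n (IrrClass.mk πv)) :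
    (((d.recGL n (IrrClass.mk πv)).out.1).tprod ((d.recGL 1 (IrrClass.mk π')).out.1)).eulerFactor d.hn d.hex =
      W.eulerFactor d.hn d.hex := by
  -- (ii): `rec₁` of the trivial character is `(1 ∘ artin, N = 0)`
  have hgl : ((d.recGL 1 (IrrClass.mk π')).out.1).IsEquivalent
      (WeilDeligneRep.ofQuasiChar d.hns d.artin 1) :=
    d.isLocalLanglands.gl_one 1 π' fun x v => by simpa using hπ' x v
  obtain ⟨e⟩ := hgl
  set B₀ := (d.recGL 1 (IrrClass.mk π')).out.1 with hB₀
  set φ : (Fin 1 → ℂ) ≃ₗ[ℂ] ℂ := e.toRepEquiv.toLinearEquiv with hφ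
  have hφρ : ∀ (u : WeilGroup F) (x : Fin 1 → ℂ),
      φ (B₀.ρ u x) = (WeilDeligneRep.ofQuasiChar d.hns d.artin 1).ρ u (φ x) := fun u x => by
    rw [hφ, Representation.Equiv.toLinearEquiv_apply, Representation.Equiv.toLinearEquiv_apply]
    exact Representation.IntertwiningMap.isIntertwining _ _ e.toRepEquiv.toIntertwiningMap u x
  have hφN : ∀ x : Fin 1 → ℂ, φ (B₀.N x) = (WeilDeligneRep.ofQuasiChar d.hns d.artin 1).N (φ x) :=
    fun x => LinearMap.congr_fun e.comm_N x
  have hBρ : ∀ (u : WeilGroup F) (x : Fin 1 → ℂ), B₀.ρ u x = x := by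
    intro u x
    apply φ.injective
    rw [hφρ, WeilDeligneRep.ofQuasiChar_ρ_apply]
    simp
  have hBN : B₀.N = 0 := by
    refine LinearMap.ext fun x => φ.injective ?_
    rw [hφN, WeilDeligneRep.ofQuasiChar_N, LinearMap.zero_apply, LinearMap.zero_apply, map_zero]
  rw [eulerFactor_tprod_eq_of_trivial _ B₀ hBρ hBN]
  -- `W ≅ (d.recGL n ⟦π⟧).out`
  have hWA : W.IsEquivalent ((d.recGL n (IrrClass.mk πv)).out.1) :=
    Quotient.exact (hq.trans (Quotient.out_eq _).symm)
  obtain ⟨e'⟩ := hWA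
  exact (eulerFactor_eq_of_equiv e' d.hn d.hex).symm

end LLC

/-! ### Part 3: the eigenline when `(1 - αX)` divides the Euler factor -/

section Line

-- `F : Type` as in `natDegree_eulerFactor_le` (`CarayolCompatibilityOfLocalGlobalProofs`)
variable {F : Type} [Field F] [ValuativeRel F] [TopologicalSpace F] [IsNonarchimedeanLocalField F]
variable {C : Type*} [Field C] [CharZero C] {V : Type*} [AddCommGroup V] [Module C V]
  [FiniteDimensional C V]

/-- **The eigenline.**  If `(1 - αX) ∣ det(1 - TΦ | (ker N)^I)` with `α ≠ 0` and
`dim (ker N)^I ≤ 1`, then `(ker N)^I` is a line on which every geometric Frobenius `Φ` acts as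
the scalar `α`: the Euler factor has constant term `1` and degree `≤ 1`, so it IS `1 - αX`; hence
`dim (ker N)^I = 1`, the characteristic polynomial of `ρ(Φ)|` is `X - α`, and Cayley–Hamilton on
the line gives `ρ(Φ)| = α`.  Tate, Corvallis 1979, (4.1.6). [cite: TateCorvallis1979, (4.1.6)] -/
theorem exists_mem_inertiaInvariantsKerN_apply_eq_smul (r : WeilDeligneRep F C V)
    (hn : absInertia_normal F) (hex : exists_isFrobPow (F := F)) {Φ : WeilGroup F}
    (hΦ : WeilGroup.deg Φ = -1) {α : C} (hα : α ≠ 0)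
    (hdvd : (1 - Polynomial.C α * X) ∣ r.eulerFactor hn hex)
    (hrank : Module.finrank C r.inertiaInvariantsKerN ≤ 1) :
    ∃ y : V, y ≠ 0 ∧ y ∈ r.inertiaInvariantsKerN ∧ r.ρ Φ y = α • y := by
  set P : C[X] := r.eulerFactor hn hex with hP
  set f := r.restrictInertiaInvariantsKerN hn Φ with hf
  have hPf : P = f.charpoly.reverse := r.eulerFactor_eq_reverse_charpoly hn hex hΦ
  have hP0 : P.coeff 0 = 1 := r.eulerFactor_coeff_zero hn hex
  have hPne : P ≠ 0 := fun h => by rw [h, Polynomial.coeff_zero] at hP0; exact zero_ne_one hP0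
  have hdegP : P.natDegree ≤ 1 := (natDegree_eulerFactor_le r hn hex).trans hrank
  -- `P = (1 - αX) G` forces `G = 1`
  obtain ⟨G, hG⟩ := hdvd
  have hD : (1 - Polynomial.C α * X : C[X]) = Polynomial.C (-α) * X + Polynomial.C 1 := by
    simp only [map_neg, map_one]; ring
  have hDdeg : (1 - Polynomial.C α * X : C[X]).natDegree = 1 := by
    rw [hD]; exact Polynomial.natDegree_linear (neg_ne_zero.2 hα)
  have hDne : (1 - Polynomial.C α * X : C[X]) ≠ 0 := fun h => by
    rw [h, Polynomial.natDegree_zero] at hDdeg; exact zero_ne_one hDdeg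
  have hGne : G ≠ 0 := fun h => hPne (by rw [hG, h, mul_zero])
  have hdegG : G.natDegree = 0 := by
    have h := Polynomial.natDegree_mul hDne hGne
    rw [← hG, hDdeg] at h
    omega
  obtain ⟨g, rfl⟩ := Polynomial.natDegree_eq_zero.1 hdegG
  have hg : g = 1 := by
    have h := hP0
    rw [hG, Polynomial.coeff_zero_eq_eval_zero, Polynomial.eval_mul, Polynomial.eval_C] at h
    simpa using h
  rw [hg, map_one, mul_one] at hG
  -- hence `dim (ker N)^I = 1` and `charpoly (ρ(Φ)|) = X - α`
  have hdeg1 : P.natDegree = 1 := by rw [hG, hDdeg]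
  have hfd : f.charpoly.natDegree = Module.finrank C r.inertiaInvariantsKerN := f.charpoly_natDegree
  have hrank1 : Module.finrank C r.inertiaInvariantsKerN = 1 := by
    refine le_antisymm hrank ?_
    rw [← hfd, ← hdeg1, hPf]
    exact Polynomial.reverse_natDegree_le _
  have hchar : f.charpoly = X + Polynomial.C (f.charpoly.coeff 0) :=
    f.charpoly_monic.eq_X_add_C (by rw [hfd, hrank1])
  have hc : f.charpoly.coeff 0 = -α := by
    have h1 : P.coeff 1 = f.charpoly.nextCoeff := by rw [hPf, Polynomial.coeff_one_reverse]
    rw [hchar, Polynomial.nextCoeff_X_add_C] at h1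
    rw [← h1, hG]
    simp [Polynomial.coeff_one]
  -- Cayley–Hamilton on the line: `f = α • 1`
  have hCH := f.aeval_self_charpoly
  rw [hchar, hc, map_add, Polynomial.aeval_X, Polynomial.aeval_C, map_neg] at hCH
  have hfα : f = algebraMap C (Module.End C r.inertiaInvariantsKerN) α := by
    rwa [add_neg_eq_zero] at hCH
  -- a non-zero vector of the line
  have hS : r.inertiaInvariantsKerN ≠ ⊥ := by
    intro h
    rw [← Submodule.finrank_eq_zero (R := C), hrank1] at h
    exact one_ne_zero h
  obtain ⟨y, hyS, hy0⟩ := (Submodule.ne_bot_iff _).1 hS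
  refine ⟨y, hy0, hyS, ?_⟩
  have h := congrArg (fun g : Module.End C r.inertiaInvariantsKerN => ((g ⟨y, hyS⟩ : r.inertiaInvariantsKerN) : V)) hfα
  simp only [hf, WeilDeligneRep.coe_restrictInertiaInvariantsKerN_apply, Module.algebraMap_end_apply,
    SetLike.mk_smul_mk] at h
  exact h

end Line

/-! ### Part 4: transport along `ι` -/

section Transport

variable {F : Type*} [Field F] [ValuativeRel F] [TopologicalSpace F] [IsNonarchimedeanLocalField F]
variable {E : Type*} [Field E] [CharZero E] {C : Type*} [Field C] [CharZero C] {n : ℕ}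
  {rv : WeilDeligneRep F E (Fin n → E)} {rC : WeilDeligneRep F C (Fin n → C)}

/-- Transport along `ι` on vectors: `ρ'(w)(ι ∘ x) = ι ∘ ρ(w)(x)`. Deligne, Antwerp II (1973),
§8.4.3. [folklore] -/
theorem _root_.Literature.NumberTheory.GaloisRepresentations.WeilDeligneRep.IsTransportAlong.apply_comp_eq {ι : E →+* C} (hT : rv.IsTransportAlong ι rC)
    (w : WeilGroup F) (x : Fin n → E) : rC.ρ w (ι ∘ x) = ι ∘ rv.ρ w x := by
  funext i
  rw [← LinearMap.toMatrix'_mulVec, hT.1 w, Function.comp_apply, ← LinearMap.toMatrix'_mulVec,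
    RingHom.map_mulVec]

/-- Transport along `ι` on vectors: `N'(ι ∘ x) = ι ∘ N(x)`. Deligne, Antwerp II (1973), §8.4.3.
[folklore] -/
theorem _root_.Literature.NumberTheory.GaloisRepresentations.WeilDeligneRep.IsTransportAlong.N_comp_eq {ι : E →+* C} (hT : rv.IsTransportAlong ι rC)
    (x : Fin n → E) : rC.N (ι ∘ x) = ι ∘ rv.N x := by
  funext i
  rw [← LinearMap.toMatrix'_mulVec, hT.2, Function.comp_apply, ← LinearMap.toMatrix'_mulVec,
    RingHom.map_mulVec]

/-- **An eigenvector of `(ker N)^I` moves back along a field isomorphism `ι : E ≃ C`.**  If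
`y ∈ (ker N')^I` of the transport `r' = ι(r)` is non-zero with `ρ'(Φ) y = α y`, then `x = ι⁻¹ ∘ y`
is a non-zero vector of `(ker N)^I` of `r` with `ρ(Φ) x = ι⁻¹(α) x`. Deligne, Antwerp II (1973),
§8.4.3. [folklore] -/
theorem _root_.Literature.NumberTheory.GaloisRepresentations.WeilDeligneRep.IsTransportAlong.exists_of_eigenvector (ι : E ≃+* C) (hT : rv.IsTransportAlong (ι : E →+* C) rC)
    {y : Fin n → C} (hy0 : y ≠ 0) (hyN : rC.N y = 0)
    (hyI : ∀ u ∈ WeilGroup.inertia F, rC.ρ u y = y) {Φ : WeilGroup F} {α : C} (hyΦ : rC.ρ Φ y = α • y) :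
    ∃ x : Fin n → E, x ≠ 0 ∧ rv.N x = 0 ∧ (∀ u ∈ WeilGroup.inertia F, rv.ρ u x = x) ∧
      rv.ρ Φ x = ι.symm α • x := by
  set x : Fin n → E := fun i => ι.symm (y i) with hx
  have hxy : ((ι : E →+* C) : E → C) ∘ x = y := by
    funext i; simp [hx]
  have hback : ∀ z : Fin n → E, (fun i => ι.symm ((((ι : E →+* C) : E → C) ∘ z) i)) = z := fun z => by
    funext i; simp
  refine ⟨x, ?_, ?_, fun u hu => ?_, ?_⟩
  · intro h0
    apply hy0
    rw [← hxy, h0]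
    funext i
    simp
  · have h := hT.N_comp_eq x
    rw [hxy, hyN] at h
    have h' := congrArg (fun z : Fin n → C => fun i => ι.symm (z i)) h
    simp only [Pi.zero_apply, map_zero] at h'
    rw [← hback (rv.N x), ← h']
    rfl
  · have h := hT.apply_comp_eq u x
    rw [hxy, hyI u hu] at h
    have h' := congrArg (fun z : Fin n → C => fun i => ι.symm (z i)) h
    rw [← hback (rv.ρ u x), ← h']
  · have h := hT.apply_comp_eq Φ x
    rw [hxy, hyΦ] at h
    have h' := congrArg (fun z : Fin n → C => fun i => ι.symm (z i)) h
    rw [← hback (rv.ρ Φ x), ← h']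
    funext i
    simp [hx, Pi.smul_apply]

/-- **The unramified case moves back along an injective `ι`.**  If `(ker N')^I = ⊤` for the
transport `r' = ι(r)`, then `N = 0` and `ρ` is trivial on inertia. Deligne, Antwerp II (1973),
§8.4.3. [folklore] -/
theorem _root_.Literature.NumberTheory.GaloisRepresentations.WeilDeligneRep.IsTransportAlong.N_eq_zero_and_ρ_eq_one_of_eq_top {ι : E →+* C} (hT : rv.IsTransportAlong ι rC)
    (hι : Function.Injective ι) (htop : rC.inertiaInvariantsKerN = ⊤) :
    rv.N = 0 ∧ ∀ u ∈ WeilGroup.inertia F, rv.ρ u = 1 := by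
  have hmem : ∀ y : Fin n → C, y ∈ rC.inertiaInvariantsKerN := fun y => htop ▸ Submodule.mem_top
  have hCN : rC.N = 0 := LinearMap.ext fun y => ((rC.mem_inertiaInvariantsKerN_iff y).1 (hmem y)).1
  have hCρ : ∀ u ∈ WeilGroup.inertia F, rC.ρ u = 1 := fun u hu =>
    LinearMap.ext fun y => ((rC.mem_inertiaInvariantsKerN_iff y).1 (hmem y)).2 u hu
  have hinj : Function.Injective (fun M : Matrix (Fin n) (Fin n) E => M.map ι) := Matrix.map_injective hι
  refine ⟨?_, fun u hu => ?_⟩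
  · apply LinearMap.toMatrix'.injective
    apply hinj
    change (LinearMap.toMatrix' rv.N).map ι = (LinearMap.toMatrix' (0 : Module.End E (Fin n → E))).map ι
    rw [← hT.2, hCN, map_zero, map_zero, Matrix.map_zero _ (map_zero ι)]
  · apply LinearMap.toMatrix'.injective
    apply hinj
    change (LinearMap.toMatrix' (rv.ρ u)).map ι =
      (LinearMap.toMatrix' (LinearMap.id : Module.End E (Fin n → E))).map ι
    rw [← hT.1 u, hCρ u hu, Module.End.one_eq_id, LinearMap.toMatrix'_id, LinearMap.toMatrix'_id,
      Matrix.map_one _ (map_zero ι) (map_one ι)]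

end Transport

/-! ### Part 5: the `ℓ`-adic side of the Grothendieck–Deligne recipe -/

section Ladic

variable {F : Type*} [Field F] [ValuativeRel F] [TopologicalSpace F] [IsNonarchimedeanLocalField F]
variable {E : Type*} [Field E] [CharZero E] {n : ℕ}

/-- `exp(A) x = x` when `A x = 0` (`A` nilpotent). [folklore] -/
theorem exp_mulVec_eq_self_of_mulVec_eq_zero {A : Matrix (Fin n) (Fin n) E} (hA : IsNilpotent A)
    {x : Fin n → E} (hx : A *ᵥ x = 0) : IsNilpotent.exp A *ᵥ x = x := by
  obtain ⟨k, hk⟩ := hA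
  have hk' : A ^ (k + 1) = 0 := by rw [pow_succ, hk, zero_mul]
  rw [IsNilpotent.exp_eq_sum hk', Matrix.sum_mulVec, Finset.sum_range_succ']
  have hzero : ∀ i ∈ Finset.range k, ((((i + 1).factorial : ℚ))⁻¹ • A ^ (i + 1)) *ᵥ x = 0 := by
    intro i _
    rw [Matrix.smul_mulVec, pow_succ, ← Matrix.mulVec_mulVec, hx, Matrix.mulVec_zero, smul_zero]
  rw [Finset.sum_eq_zero hzero, zero_add, pow_zero, Nat.factorial_zero, Nat.cast_one, inv_one, one_smul,
    Matrix.one_mulVec]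

variable {ρW : WeilGroup F →* GL (Fin n) E} {rv : WeilDeligneRep F E (Fin n → E)}

/-- **Inertia acts trivially on `(ker N)^{I}`-type vectors of the `ℓ`-adic representation.**  If
`(ρ_WD, N)` is attached to `ρW` by the Grothendieck–Deligne recipe (`ρW(u) = ρ_WD(u) exp(t(u)N)` on
inertia), `u ∈ I_F`, `N x = 0` and `ρ_WD(u) x = x`, then `ρW(u) x = x`. Tate, Corvallis 1979,
(4.2.1); Deligne, Antwerp II (1973), §8.4.2. [cite: TateCorvallis1979, (4.2.1)] -/
theorem _root_.Literature.NumberTheory.GaloisRepresentations.IsWeilDeligneOfLadic.mulVec_eq_self_of_mem_inertia (h : IsWeilDeligneOfLadic ρW rv)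
    {u : WeilGroup F} (hu : u ∈ WeilGroup.inertia F) {x : Fin n → E} (hNx : rv.N x = 0)
    (hρx : rv.ρ u x = x) :
    ((ρW u : GL (Fin n) E) : Matrix (Fin n) (Fin n) E) *ᵥ x = x := by
  obtain ⟨t, U, Φ₀, -, -, -, -, -, hρ⟩ := h
  set Nm : Matrix (Fin n) (Fin n) E := LinearMap.toMatrix' rv.N with hNm
  have hNil : IsNilpotent Nm := rv.isNilpotent_N.map LinearMap.toMatrixAlgEquiv'
  have hNmx : Nm *ᵥ x = 0 := by rw [hNm, LinearMap.toMatrix'_mulVec, hNx]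
  set c : E := (t ⟨u, hu⟩).toAdd with hc
  have hcN : IsNilpotent (c • Nm) := hNil.smul c
  have hcNx : (c • Nm) *ᵥ x = 0 := by rw [Matrix.smul_mulVec, hNmx, smul_zero]
  -- the recipe at `m = 0`: `ρ_WD(u) = ρW(u) exp(-t(u)N)`
  have h0 := hρ 0 ⟨u, hu⟩
  rw [zpow_zero, one_mul] at h0
  change LinearMap.toMatrix' (rv.ρ u) = ((ρW u : GL (Fin n) E) : Matrix (Fin n) (Fin n) E) *
    IsNilpotent.exp (-(c • Nm)) at h0
  have hW : ((ρW u : GL (Fin n) E) : Matrix (Fin n) (Fin n) E) =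
      LinearMap.toMatrix' (rv.ρ u) * IsNilpotent.exp (c • Nm) := by
    rw [h0, mul_assoc, IsNilpotent.exp_neg_mul_exp_self hcN, mul_one]
  rw [hW, ← Matrix.mulVec_mulVec, exp_mulVec_eq_self_of_mulVec_eq_zero hcN hcNx, LinearMap.toMatrix'_mulVec,
    hρx]

/-- **The geometric Frobenius of the recipe acts through `ρ_WD`**: there is `Φ` of degree `-1`
with `ρW(Φ) = ρ_WD(Φ)` (the clause `m = 1`, `u = 1` of `IsWeilDeligneOfLadic`).
Tate, Corvallis 1979, (4.2.1). [cite: TateCorvallis1979, (4.2.1)] -/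
theorem _root_.Literature.NumberTheory.GaloisRepresentations.IsWeilDeligneOfLadic.exists_deg_eq_neg_one_mulVec_eq (h : IsWeilDeligneOfLadic ρW rv) :
    ∃ Φ : WeilGroup F, WeilGroup.deg Φ = -1 ∧
      ∀ x : Fin n → E, ((ρW Φ : GL (Fin n) E) : Matrix (Fin n) (Fin n) E) *ᵥ x = rv.ρ Φ x := by
  obtain ⟨t, U, Φ₀, -, -, hΦ₀, -, -, hρ⟩ := h
  refine ⟨Φ₀, hΦ₀, fun x => ?_⟩
  have h1 := hρ 1 1
  rw [zpow_one, OneMemClass.coe_one, mul_one, map_one, toAdd_one, zero_smul, neg_zero,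
    IsNilpotent.exp_zero, mul_one] at h1
  rw [← LinearMap.toMatrix'_mulVec, h1]

/-- **Unramified `(ρ_WD, N)` gives unramified `ρW`**: if `N = 0` and `ρ_WD` is trivial on inertia
then `ρW(u) = 1` for `u ∈ I_F` (the clause `m = 0` with `exp(0) = 1`).  Tate, Corvallis 1979,
(4.2.1). [cite: TateCorvallis1979, (4.2.1)] -/
theorem _root_.Literature.NumberTheory.GaloisRepresentations.IsWeilDeligneOfLadic.eq_one_of_mem_inertia_of_N_eq_zero (h : IsWeilDeligneOfLadic ρW rv)
    (hN : rv.N = 0) (hρ1 : ∀ u ∈ WeilGroup.inertia F, rv.ρ u = 1) {u : WeilGroup F}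
    (hu : u ∈ WeilGroup.inertia F) : ρW u = 1 := by
  obtain ⟨t, U, Φ₀, -, -, -, -, -, hρ⟩ := h
  have h0 := hρ 0 ⟨u, hu⟩
  rw [zpow_zero, one_mul] at h0
  change LinearMap.toMatrix' (rv.ρ u) = ((ρW u : GL (Fin n) E) : Matrix (Fin n) (Fin n) E) *
    IsNilpotent.exp (-((t ⟨u, hu⟩).toAdd • LinearMap.toMatrix' rv.N)) at h0
  rw [hN, map_zero, smul_zero, neg_zero, IsNilpotent.exp_zero, mul_one, hρ1 u hu, Module.End.one_eq_id,
    LinearMap.toMatrix'_id] at h0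
  exact Units.val_eq_one.1 h0.symm

end Ladic

end Literature.NumberTheory.Automorphic

end
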